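import Literature.Computability.Cryptography.PeriodFindingLaw
import HarnessLib

/-!
# Period finding by eigenvalue estimation of shifts, IV: one trial — accuracy of the phase estimate

Family `PQC` / quantum-advantage barrier `PPolyOracles`; fourth file towards the discharge of
`Literature.Barriers.QuantumAdvantage.aaronsonChen2017_lem75_quantum` (Aaronson–Chen 2017,
Lemma 7.5 (2)–(3), App. 13: Boneh–Lipton period finding). Given the read-out law of the shift
experiment (`PeriodFindingLaw.lean`: given the character `c` of a unit, its controls are
independent Hadamard tests of the phases `2^l c / Q`), this file analyses ONE trial exactly as
Kitaev's order-finding experiment is analysed in `ShorOrderFindingQuantum.lean` (block counts,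
quadrant localisation, halving refinement, Chebyshev per block), but with the block size `B` and
the number of levels `Lv` as PARAMETERS (the distinguisher probes polynomially many candidate
block lengths, so the per-trial failure probability must be made polynomially small) and with an
EXACT recovery of the character: for `2^{Lv−1} ≥ Q` an accurate read-out determines `c` itself
(`cEst`, rounding the refined estimate to the nearest multiple of `1/Q`), so that the classical
recovery of the period runs on the exact rational `c/Q` (`Shor1997.candidate_div_eq`).

* test labels `TIdx Lv B = level × type × repetition`, weights `uWeight`, `trialWeight`
  (a probability vector), blocks `tblock`, counts `cntU`, estimates `levelEstU`, `phaseEstU`,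
  `AccurateU`;
* `cdist_levelEstU_le`, `cdist_phaseEstU_le` (Kitaev 1995, §3, Lemma 10), `cEst_eq_of_accurate`;
* `sum_not_accurateU_le`: inaccurate read-outs have weight `≤ 2 Lv · 64 / B` under every `c`
  (Chebyshev, `Kitaev1995.chebyshev_block`, and a union bound over the `2 Lv` blocks);
* `isCandidate_of_candidate_eq`, `card_filter_candidate_eq_le`: for `v ≠ 0` at most `2 (v + 1)`
  characters `c < Q` have `Shor1997.candidate n Q (c/Q) = v` (the false-collision count of the
  distinguisher on permutation tables).

## References

* A. Yu. Kitaev, arXiv:quant-ph/9511026 (1995), §3 (before Lemma 9; Lemma 10; Thm. 1) [Kitaev1995].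
* P. W. Shor, SIAM J. Comput. 26 (1997) 1484–1509, §5 [Shor1997].
* S. Aaronson, L. Chen, CCC 2017 (arXiv:1612.05903), Lemma 7.5, App. 13 [AaronsonChen2017].
-/

noncomputable section

namespace Literature.Computability.Cryptography

namespace PeriodFinding

open Finset Kitaev1995 Real

/-! ### One trial: test labels and their weights -/

/-- The test labels of one trial: `(level, type, repetition)`; type `true` = sine test. [folklore] -/
abbrev TIdx (Lv B : ℕ) : Type := Fin Lv × Bool × Fin B

variable {Lv B : ℕ}

/-- The test angle at level `l` for the character `c` modulo `Q`: `2π c 2^l / Q`.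
[cite: Kitaev1995, §3 (Lemma 10)] -/
def uAngle (Q c l : ℕ) : ℝ := 2 * π * (c : ℝ) * 2 ^ l / Q

/-- The weight of outcome `b` of the test `τ` under the character `c`. [cite: Kitaev1995, §3 Remark 8] -/
def uWeight (Q c : ℕ) (τ : TIdx Lv B) (b : Bool) : ℝ := testWeight b τ.2.1 (uAngle Q c τ.1)

/-- Test weights are nonnegative. [folklore] -/
theorem uWeight_nonneg (Q c : ℕ) (τ : TIdx Lv B) (b : Bool) : 0 ≤ uWeight Q c τ b :=
  testWeight_nonneg _ _ _

/-- The two outcomes of a test have total weight `1`. [folklore] -/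
theorem uWeight_false_add_true (Q c : ℕ) (τ : TIdx Lv B) :
    uWeight Q c τ false + uWeight Q c τ true = 1 :=
  testWeight_false_add_true _ _

/-- The weight of the read-out `γ` of a trial under `c`: independent tests. [cite: Kitaev1995, §3 Lemma 8] -/
def trialWeight (Q c : ℕ) (γ : TIdx Lv B → Bool) : ℝ := ∏ τ, uWeight Q c τ (γ τ)

/-- Trial weights are nonnegative. [folklore] -/
theorem trialWeight_nonneg (Q c : ℕ) (γ : TIdx Lv B → Bool) : 0 ≤ trialWeight Q c γ :=
  prod_nonneg fun τ _ => uWeight_nonneg Q c τ _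

/-- **Trial weights are a probability vector.** [folklore] -/
theorem sum_trialWeight (Q c : ℕ) : ∑ γ : TIdx Lv B → Bool, trialWeight Q c γ = 1 :=
  sum_prodWeight (uWeight Q c) (uWeight_false_add_true Q c)

/-! ### Blocks, counts and the estimates -/

/-- The block of the `B` repetitions of the test `(l, σ)`. [folklore] -/
def tblock (l : Fin Lv) (σ : Bool) : Finset (TIdx Lv B) := univ.filter fun τ => τ.1 = l ∧ τ.2.1 = σ

/-- Membership in a block. [folklore] -/
theorem mem_tblock {l : Fin Lv} {σ : Bool} {τ : TIdx Lv B} : τ ∈ tblock l σ ↔ τ.1 = l ∧ τ.2.1 = σ := by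
  simp [tblock]

/-- A block is the image of the repetitions. [folklore] -/
theorem tblock_eq_image (l : Fin Lv) (σ : Bool) :
    (tblock l σ : Finset (TIdx Lv B)) = univ.image fun i : Fin B => (l, σ, i) := by
  ext τ
  obtain ⟨l', σ', i⟩ := τ
  simp only [mem_tblock, mem_image, mem_univ, true_and, Prod.mk.injEq]
  constructor
  · rintro ⟨rfl, rfl⟩
    exact ⟨i, rfl, rfl, rfl⟩
  · rintro ⟨i', rfl, rfl, rfl⟩
    exact ⟨rfl, rfl⟩

/-- Every block consists of `B` tests. [folklore] -/
theorem card_tblock (l : Fin Lv) (σ : Bool) : (tblock l σ : Finset (TIdx Lv B)).card = B := by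
  rw [tblock_eq_image, card_image_of_injective _ fun i i' h => by simpa using h]
  simp

/-- The number of `1`s read in the block `(l, σ)`. [cite: Kitaev1995, §3 (before Lemma 9)] -/
def cntU (γ : TIdx Lv B → Bool) (l : Fin Lv) (σ : Bool) : ℕ :=
  ((tblock l σ).filter fun τ => γ τ = true).card

/-- The quadrant centre localising `2^l φ`. [cite: Kitaev1995, §3 Lemma 10] -/
def levelEstU (γ : TIdx Lv B → Bool) (l : Fin Lv) : ℚ :=
  quadrantCenter (decide (2 * cntU γ l false ≤ B)) (decide (2 * cntU γ l true ≤ B))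

/-- The refined estimate of the phase `φ = c/Q` (halving from the top level down). [cite: Kitaev1995, §3 Lemma 10] -/
def phaseEstU (γ : TIdx Lv B → Bool) : ℚ :=
  refined (fun l => if h : l < Lv then levelEstU γ ⟨l, h⟩ else 0) Lv

/-- `AccurateU Q c γ`: in every block the number of `1`s is within `B/16` of its mean under `c`.
[cite: Kitaev1995, §3 (before Lemma 9)] -/
def AccurateU (Q c : ℕ) (γ : TIdx Lv B → Bool) : Prop :=
  ∀ (l : Fin Lv) (σ : Bool),
    |(cntU γ l σ : ℝ) - ∑ τ ∈ tblock (B := B) l σ, uWeight Q c τ true| < B / 16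

/-- The mean number of `1`s in a block. [folklore] -/
theorem sum_uWeight_tblock (Q c : ℕ) (l : Fin Lv) (σ : Bool) :
    ∑ τ ∈ (tblock l σ : Finset (TIdx Lv B)), uWeight Q c τ true =
      B * testWeight true σ (uAngle Q c l) := by
  rw [sum_congr rfl fun τ hτ => by
    obtain ⟨h1, h2⟩ := mem_tblock.1 hτ
    rw [uWeight, h1, h2], sum_const, card_tblock, nsmul_eq_mul]

/-- **Accurate read-outs localise every level**: `cdist (levelEstU γ l) (2^l c / Q) ≤ 5/32`.
[cite: Kitaev1995, §3 Lemma 10] -/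
theorem cdist_levelEstU_le {Q c : ℕ} (hB : 0 < B) {γ : TIdx Lv B → Bool}
    (hacc : AccurateU Q c γ) (l : Fin Lv) :
    cdist (levelEstU γ l) (2 ^ (l : ℕ) * (c : ℚ) / Q) ≤ 5 / 32 := by
  have hcos := hacc l false
  have hsin := hacc l true
  rw [sum_uWeight_tblock] at hcos hsin
  simp only [testWeight, if_true, if_false, Bool.false_eq_true] at hcos hsin
  set θ : ℝ := uAngle Q c l with hθ
  obtain ⟨hc1, hc2⟩ := trigEst_of_cnt (c₀ := Real.cos θ) hB hcos
  obtain ⟨hs1, hs2⟩ := trigEst_of_cnt (c₀ := Real.sin θ) hB hsin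
  have hθ' : 2 * π * (((2 ^ (l : ℕ) * (c : ℚ) / Q : ℚ)) : ℝ) = θ := by
    rw [hθ, uAngle]; push_cast; ring
  unfold levelEstU
  refine cdist_quadrantCenter_le_bool hc2 hs2 ?_ ?_
  · rw [hθ']; exact hc1
  · rw [hθ']; exact hs1

/-- **Accurate read-outs estimate the phase to within `(5/32)/2^{Lv−1}`.**
[cite: Kitaev1995, §3 Lemma 10] -/
theorem cdist_phaseEstU_le {Q c : ℕ} (hB : 0 < B) (hLv : 0 < Lv) {γ : TIdx Lv B → Bool}
    (hacc : AccurateU Q c γ) :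
    cdist (phaseEstU γ) ((c : ℚ) / Q) ≤ 5 / 32 / 2 ^ (Lv - 1) := by
  rw [phaseEstU]
  refine cdist_refined_le hLv fun l hl => ?_
  rw [dif_pos hl, show (2 : ℚ) ^ l * ((c : ℚ) / Q) = 2 ^ l * (c : ℚ) / Q by ring]
  exact cdist_levelEstU_le hB hacc ⟨l, hl⟩

/-! ### Exact recovery of the character -/

/-- **The character read off a trial**: round the refined estimate to the nearest multiple of
`1/Q` and reduce modulo `Q`. [cite: Kitaev1995, §3 Thm 1] -/
def cEst (Q : ℕ) (γ : TIdx Lv B → Bool) : ℕ :=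
  ((round ((phaseEstU γ : ℚ) * Q) : ℤ) % (Q : ℤ)).toNat

/-- `cEst` is a character: `cEst Q γ < Q`. [folklore] -/
theorem cEst_lt {Q : ℕ} (hQ : 0 < Q) (γ : TIdx Lv B → Bool) : cEst Q γ < Q := by
  unfold cEst
  have h1 : 0 ≤ (round ((phaseEstU γ : ℚ) * Q) : ℤ) % (Q : ℤ) :=
    Int.emod_nonneg _ (by exact_mod_cast hQ.ne')
  have h2 : (round ((phaseEstU γ : ℚ) * Q) : ℤ) % (Q : ℤ) < Q :=
    Int.emod_lt_of_pos _ (by exact_mod_cast hQ)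
  omega

/-- Rounding recovers an integer from an estimate at distance `< 1/2`. [folklore] -/
theorem round_eq_of_abs_sub_lt {x : ℚ} {n : ℤ} (h : |x - n| < 1 / 2) : round x = n := by
  rw [round_eq_iff, Set.mem_Ico]
  rw [abs_lt] at h
  constructor <;> linarith

/-- **An accurate read-out determines the character exactly** once `2^{Lv−1} ≥ Q`: the
estimate is within `(5/32)/Q < 1/(2Q)` of `c/Q` modulo `1`. [cite: Kitaev1995, §3 Thm 1] -/
theorem cEst_eq_of_accurate {Q c : ℕ} (hB : 0 < B) (hLv : 0 < Lv) (hQ : Q ≤ 2 ^ (Lv - 1))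
    (hcQ : c < Q) {γ : TIdx Lv B → Bool} (hacc : AccurateU Q c γ) : cEst Q γ = c := by
  have hQ0 : 0 < Q := by omega
  have hQq : (0 : ℚ) < Q := by exact_mod_cast hQ0
  obtain ⟨N, hN⟩ := exists_cdist_eq (phaseEstU γ) ((c : ℚ) / Q)
  have hclose := cdist_phaseEstU_le hB hLv hacc (Q := Q) (c := c)
  rw [hN] at hclose
  -- `|ξ Q − (c + N Q)| ≤ 5/32 · Q / 2^{Lv-1} ≤ 5/32 < 1/2`
  have hpow : (Q : ℚ) ≤ 2 ^ (Lv - 1) := by exact_mod_cast hQ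
  have hround : round ((phaseEstU γ : ℚ) * Q) = (c : ℤ) + N * Q := by
    apply round_eq_of_abs_sub_lt
    have h1 : (phaseEstU γ : ℚ) * Q - (((c : ℤ) + N * Q : ℤ) : ℚ) =
        (phaseEstU γ - (c : ℚ) / Q - N) * Q := by
      push_cast
      field_simp
      ring
    rw [h1, abs_mul, abs_of_pos hQq]
    have h2 : |phaseEstU γ - (c : ℚ) / Q - N| * Q ≤ 5 / 32 / 2 ^ (Lv - 1) * 2 ^ (Lv - 1) :=
      mul_le_mul hclose hpow hQq.le (by positivity)
    have h3 : (5 : ℚ) / 32 / 2 ^ (Lv - 1) * 2 ^ (Lv - 1) = 5 / 32 := by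
      field_simp
    linarith
  unfold cEst
  rw [hround, Int.add_mul_emod_self_right, Int.emod_eq_of_lt (by positivity) (by exact_mod_cast hcQ)]
  rfl

/-! ### Accurate read-outs are likely -/

open scoped Classical in
/-- **Inaccurate read-outs are rare**: under every `c` the read-outs of a trial that are not
accurate have total weight `≤ 2 Lv · 64 / B` (Chebyshev per block and a union bound over the
`2 Lv` blocks of `B` tests). [cite: Kitaev1995, §3 (before Lemma 9)] -/
theorem sum_not_accurateU_le (hB : 0 < B) (Q c : ℕ) :
    ∑ γ ∈ univ.filter (fun γ : TIdx Lv B → Bool => ¬ AccurateU Q c γ), trialWeight Q c γ ≤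
      (2 * Lv : ℕ) * ((64 : ℝ) / B) := by
  classical
  have hBr : (0 : ℝ) < B := by exact_mod_cast hB
  have hsub : (univ.filter fun γ : TIdx Lv B → Bool => ¬ AccurateU Q c γ) =
      univ.filter fun γ : TIdx Lv B → Bool => ∃ β : Fin Lv × Bool,
        (B : ℝ) / 16 ≤ |(cntU γ β.1 β.2 : ℝ) - ∑ τ ∈ tblock (B := B) β.1 β.2, uWeight Q c τ true| := by
    refine filter_congr fun γ _ => ?_
    simp only [AccurateU, not_forall, not_lt, Prod.exists]
  rw [hsub]
  refine (sum_filter_exists_le _ (fun γ => trialWeight_nonneg Q c γ) _).trans ?_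
  have hblock : ∀ β : Fin Lv × Bool, ∑ γ ∈ univ.filter (fun γ : TIdx Lv B → Bool =>
      (B : ℝ) / 16 ≤ |(cntU γ β.1 β.2 : ℝ) - ∑ τ ∈ tblock (B := B) β.1 β.2, uWeight Q c τ true|),
        trialWeight Q c γ ≤ 64 / B := by
    intro β
    have h := chebyshev_block (uWeight (Lv := Lv) (B := B) Q c) (uWeight_nonneg Q c)
      (uWeight_false_add_true Q c) (tblock β.1 β.2) (a := (B : ℝ) / 16) (by positivity)
    rw [card_tblock] at h
    refine (le_of_eq ?_).trans (h.trans (le_of_eq ?_))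
    · rfl
    · field_simp
      ring
  calc ∑ β : Fin Lv × Bool, ∑ γ ∈ univ.filter (fun γ : TIdx Lv B → Bool =>
        (B : ℝ) / 16 ≤ |(cntU γ β.1 β.2 : ℝ) - ∑ τ ∈ tblock (B := B) β.1 β.2, uWeight Q c τ true|),
          trialWeight Q c γ
      ≤ ∑ _β : Fin Lv × Bool, (64 : ℝ) / B := sum_le_sum fun β _ => hblock β
    _ = (2 * Lv : ℕ) * ((64 : ℝ) / B) := by
        rw [sum_const, card_univ, nsmul_eq_mul, Fintype.card_prod, Fintype.card_fin,
          Fintype.card_bool]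
        push_cast
        ring

open scoped Classical in
/-- **Accurate read-outs are likely**: total weight `≥ 1 − 2 Lv · 64 / B` under every `c`.
[cite: Kitaev1995, §3 (before Lemma 9)] -/
theorem sum_accurateU_ge (hB : 0 < B) (Q c : ℕ) :
    1 - (2 * Lv : ℕ) * ((64 : ℝ) / B) ≤
      ∑ γ ∈ univ.filter (fun γ : TIdx Lv B → Bool => AccurateU Q c γ), trialWeight Q c γ := by
  classical
  have htot := sum_trialWeight (Lv := Lv) (B := B) Q c
  rw [← sum_filter_add_sum_filter_not univ (fun γ => AccurateU Q c γ)] at htot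
  have := sum_not_accurateU_le (Lv := Lv) hB Q c
  linarith

/-! ### The classical recovery on exact characters -/

/-- A nonzero candidate value satisfies the candidate specification. [cite: Shor1997, §5 (continued fraction recovery of d/r)] -/
theorem isCandidate_of_candidate_eq {n q v : ℕ} {ξ : ℝ} (h : Shor1997.candidate n q ξ = v)
    (hv : v ≠ 0) : Shor1997.IsCandidate n q ξ v := by
  classical
  unfold Shor1997.candidate at h
  split_ifs at h with hex
  · rw [← h]
    exact Nat.find_spec hex
  · exact absurd h.symm hv

/-- **Few characters share a candidate**: for `v ≠ 0` and `v < 2Q`... precisely, for `0 < v`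
with `v < 2 Q`, at most `2 (v + 1)` characters `c < Q` have `candidate n Q (c/Q) = v` (each
witness numerator `d ∈ [0, v]` accounts for at most two consecutive `c`).
[cite: Shor1997, §5 (continued fraction recovery of d/r)] -/
theorem card_filter_candidate_eq_le {n Q v : ℕ} (hQ : 0 < Q) (hv : v ≠ 0) (hvQ : v < 2 * Q) :
    ((range Q).filter fun c : ℕ => Shor1997.candidate n Q ((c : ℝ) / Q) = v).card ≤
      2 * (v + 1) := by
  classical
  set S := (range Q).filter fun c : ℕ => Shor1997.candidate n Q ((c : ℝ) / Q) = v with hS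
  have hQr : (0 : ℝ) < Q := by exact_mod_cast hQ
  have hvr : (0 : ℝ) < v := by exact_mod_cast Nat.pos_of_ne_zero hv
  -- every `c ∈ S` has a numerator `d ∈ [0, v]` with `|c v − d Q| ≤ v/2`
  have hwit : ∀ c ∈ S, ∃ d : ℤ, 0 ≤ d ∧ d ≤ v ∧ 2 * |(c : ℝ) * v - d * Q| ≤ v := by
    intro c hc
    rw [hS, mem_filter, mem_range] at hc
    obtain ⟨hcQ, hcv⟩ := hc
    obtain ⟨-, -, d, hd⟩ := isCandidate_of_candidate_eq hcv hv
    have hcr : (0 : ℝ) ≤ c := Nat.cast_nonneg _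
    have hcQ' : (c : ℝ) < Q := by exact_mod_cast hcQ
    have key : 2 * |(c : ℝ) * v - d * Q| ≤ v := by
      have h1 : (c : ℝ) * v - d * Q = ((c : ℝ) / Q - d / v) * (Q * v) := by
        field_simp
      rw [h1, abs_mul, abs_of_pos (mul_pos hQr hvr)]
      have h2 : |(c : ℝ) / Q - d / v| * (Q * v) ≤ 1 / (2 * Q) * (Q * v) :=
        mul_le_mul_of_nonneg_right hd (mul_pos hQr hvr).le
      have h3 : 1 / (2 * (Q : ℝ)) * (Q * v) = v / 2 := by field_simp
      linarith
    refine ⟨d, ?_, ?_, key⟩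
    · -- `d/v ≥ c/Q − 1/(2Q) ≥ −1/(2Q) > −1/v`... in integers: `d Q ≥ c v − v/2 ≥ −v/2 > −Q`
      by_contra hneg
      push Not at hneg
      have hd1 : (d : ℝ) ≤ -1 := by exact_mod_cast Int.le_sub_one_iff.2 hneg
      have := (abs_le.1 (by linarith [key] : |(c : ℝ) * v - d * Q| ≤ v / 2)).2
      have hvQ' : (v : ℝ) < 2 * Q := by exact_mod_cast hvQ
      have hp1 : (1 : ℝ) * Q ≤ (-(d : ℝ)) * Q := mul_le_mul_of_nonneg_right (by linarith) hQr.le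
      have hp2 : (0 : ℝ) ≤ (c : ℝ) * v := mul_nonneg hcr hvr.le
      linarith
    · by_contra hbig
      push Not at hbig
      have hd1 : (v : ℝ) + 1 ≤ d := by exact_mod_cast Int.add_one_le_iff.2 hbig
      have := (abs_le.1 (by linarith [key] : |(c : ℝ) * v - d * Q| ≤ v / 2)).1
      have hvQ' : (v : ℝ) < 2 * Q := by exact_mod_cast hvQ
      have hp1 : ((v : ℝ) + 1) * Q ≤ (d : ℝ) * Q := mul_le_mul_of_nonneg_right hd1 hQr.le
      have hp2 : (c : ℝ) * v < Q * v := mul_lt_mul_of_pos_right hcQ' hvr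
      nlinarith
  choose! dOf hd0 hdv hdc using hwit
  -- `c ↦ (d(c), c mod 2)` is injective on `S`
  have hinj : Set.InjOn (fun c : ℕ => (dOf c, c % 2)) (S : Set ℕ) := by
    intro c hc c' hc' h
    simp only [Prod.mk.injEq] at h
    obtain ⟨hd, hpar⟩ := h
    have h1 := hdc c hc
    have h2 := hdc c' hc'
    rw [← hd] at h2
    -- `|c − c'| v ≤ v`, so `|c − c'| ≤ 1`, and equal parity forces `c = c'`
    have h3 : |((c : ℝ) - c') * v| ≤ v := by
      have := abs_sub_abs_le_abs_sub ((c : ℝ) * v - dOf c * Q) ((c' : ℝ) * v - dOf c * Q)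
      rw [show (c : ℝ) * v - dOf c * Q - ((c' : ℝ) * v - dOf c * Q) = ((c : ℝ) - c') * v by ring]
        at this
      have h4 : |(c : ℝ) * v - dOf c * Q - ((c' : ℝ) * v - dOf c * Q)| ≤
          |(c : ℝ) * v - dOf c * Q| + |(c' : ℝ) * v - dOf c * Q| := abs_sub _ _
      rw [show (c : ℝ) * v - dOf c * Q - ((c' : ℝ) * v - dOf c * Q) = ((c : ℝ) - c') * v by ring]
        at h4
      linarith
    rw [abs_mul, abs_of_pos hvr] at h3
    have h5 : |(c : ℝ) - c'| ≤ 1 := by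
      by_contra h6
      push Not at h6
      nlinarith
    have h7 : (c : ℤ) - c' ≤ 1 ∧ -1 ≤ (c : ℤ) - c' := by
      rw [abs_le] at h5
      constructor
      · exact_mod_cast h5.2
      · exact_mod_cast h5.1
    omega
  -- its image lies in `[0, v] × {0, 1}`
  have himg : S.image (fun c : ℕ => (dOf c, c % 2)) ⊆ (Finset.Icc (0 : ℤ) v) ×ˢ range 2 := by
    intro p hp
    obtain ⟨c, hc, rfl⟩ := mem_image.1 hp
    exact mem_product.2 ⟨mem_Icc.2 ⟨hd0 c hc, hdv c hc⟩, mem_range.2 (Nat.mod_lt _ (by norm_num))⟩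
  calc S.card = (S.image fun c : ℕ => (dOf c, c % 2)).card := (card_image_of_injOn hinj).symm
    _ ≤ ((Finset.Icc (0 : ℤ) v) ×ˢ range 2).card := card_le_card himg
    _ = 2 * (v + 1) := by
        rw [card_product, Int.card_Icc, card_range]
        simp
        omega

end PeriodFinding

end Literature.Computability.Cryptography

end
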